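import Summits.QuantumFields.YangMills.Theorems.VirialFluxGapFixCoordDefs
import Summits.QuantumFields.YangMills.Theorems.LuscherReductionRunningReductionAxialWindow
import Literature.MathematicalPhysics.QuantumFieldTheory.Balaban1983to89.MassGapTransferHC
import Summits.QuantumFields.YangMills.Theorems.LuscherReductionTwistedTraceScalingLatticeHS
import HarnessLib

/-!
# `dim V = 18L⁴`: the comb tree has `L³ − 1` edges, `X_fix` has `6L⁴ + 1` components, the slice model has dimension `fixDim = 18L⁴`
# (bookkeeping for layer (B2)∕(B3) of the DIRECT Laplace road to ⟨stmt-QuantumFields-24204⟩ `VirialFluxGap.SharpTwistedLaplace`)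

Helper module (free-hands work of width seat ym-line-sfw-p2-w3 g57, cell ym-idea-1; `--supports 24204`).  The orbit theorem produces the Gaussian factor
`(2π/β)^{finrank V / 2}` with `V = EuclideanSpace ℝ (Fin (fixDim L e₀ y₀))`, while ✓`sharpTwistedLaplace_of_fixTubes` wants `(2π/β)^{9L⁴}`.  Here:
* `card_treeIdx` — the comb spanning tree of ✓`LuscherReductionRunningReductionTreeGauge.treeEdge` has exactly `L³ − 1` edges (direction `2`: `L²(L−1)`,
  direction `1`: `L(L−1)`, direction `0`: `L − 1`);
* `card_offIdx` (`= 2L³ + 1`, with ✓`card_tree_add_card_off`, ✓`FemtoTransferGap.card_edge_three`);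
* ★ `fixDim_eq` — `fixDim L e₀ y₀ = 18 L⁴`; `finrank_fixModel` — `finrank ℝ V = 18 L⁴`, so `finrank V / 2 = 9L⁴`.
Everything here is PROVED; no definitions, no named facts.  HONEST FRAMING: counting; ⟨24204⟩, ⟨24319⟩ and every rung stay OPEN; the Yang–Mills mass gap
(Clay) is NOT touched; no summit is proved by a line.

## References
* E. Seiler, *Gauge Theories as a Problem of Constructive QFT*, LNP 159 (1982), §2 (maximal trees). [SeilerLNP1982]
-/

set_option autoImplicit false

noncomputable section

open Finset Module
open Literature.MathematicalPhysics.QuantumLattice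
open Literature.MathematicalPhysics.QuantumFieldTheory hiding SU2
open Summit.QuantumFields.YangMills.Theorems.FemtoTransferGap
open Summit.QuantumFields.YangMills.Theorems.FemtoTransferGap.TT

namespace Summit.QuantumFields.YangMills.Theorems.VirialFluxGap.FixSplit

variable {L : ℕ} [NeZero L]

/-! ## §1 Sums over sites as triple sums -/

variable (L) in
/-- Summing over sites `Fin 3 → ZMod L` is a triple sum over the coordinates. [folklore] -/
theorem sum_site_eq_sum_coord (F : ZMod L → ZMod L → ZMod L → ℕ) :
    ∑ x : Site 3 L, F (x 0) (x 1) (x 2) = ∑ a : ZMod L, ∑ b : ZMod L, ∑ c : ZMod L, F a b c := by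
  let e : Site 3 L ≃ ZMod L × ZMod L × ZMod L :=
    { toFun := fun x => (x 0, x 1, x 2)
      invFun := fun p => ![p.1, p.2.1, p.2.2]
      left_inv := fun x => by funext i; fin_cases i <;> rfl
      right_inv := fun p => rfl }
  rw [Fintype.sum_equiv e (fun x : Site 3 L => F (x 0) (x 1) (x 2)) (fun p : ZMod L × ZMod L × ZMod L => F p.1 p.2.1 p.2.2) (fun x => rfl)]
  simp only [Fintype.sum_prod_type]

/-- `#{c : ZMod L | c ≠ a} = L − 1`. [folklore] -/
theorem sum_ite_ne (a : ZMod L) : ∑ c : ZMod L, (if c ≠ a then 1 else 0) = L - 1 := by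
  rw [Finset.sum_boole, Finset.filter_ne', Finset.card_erase_of_mem (Finset.mem_univ a), Finset.card_univ, ZMod.card]
  rfl

/-! ## §2 The comb tree has `L³ − 1` edges -/

omit [NeZero L] in
/-- The tree-edge indicator at a site, summed over the three directions. [cite: SeilerLNP1982, §2] -/
theorem sum_dir_treeEdge (x : Site 3 L) :
    ∑ d : Fin 3, (if treeEdge (x, d) = true then 1 else 0) =
      (if x 1 = 0 ∧ x 2 = 0 ∧ x 0 ≠ -1 then 1 else 0) + (if x 2 = 0 ∧ x 1 ≠ -1 then 1 else 0) + (if x 2 ≠ -1 then 1 else 0) := by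
  rw [Fin.sum_univ_three]
  have h0 : (treeEdge (x, (0 : Fin 3)) = true) ↔ (x 1 = 0 ∧ x 2 = 0 ∧ x 0 ≠ -1) := by
    rw [treeEdge_iff]
    constructor
    · rintro (⟨h, -⟩ | ⟨h, -⟩ | ⟨-, h⟩)
      · simp at h
      · simp at h
      · exact h
    · exact fun h => Or.inr (Or.inr ⟨rfl, h⟩)
  have h1 : (treeEdge (x, (1 : Fin 3)) = true) ↔ (x 2 = 0 ∧ x 1 ≠ -1) := by
    rw [treeEdge_iff]
    constructor
    · rintro (⟨h, -⟩ | ⟨-, h⟩ | ⟨h, -⟩)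
      · simp at h
      · exact h
      · simp at h
    · exact fun h => Or.inr (Or.inl ⟨rfl, h⟩)
  have h2 : (treeEdge (x, (2 : Fin 3)) = true) ↔ (x 2 ≠ -1) := by
    rw [treeEdge_iff]
    constructor
    · rintro (⟨-, h⟩ | ⟨h, -⟩ | ⟨h, -⟩)
      · exact h
      · simp at h
      · simp at h
    · exact fun h => Or.inl ⟨rfl, h⟩
  simp only [h0, h1, h2]

/-- ★ **The comb tree has `L³ − 1` edges.** [cite: SeilerLNP1982, §2] -/
theorem card_treeIdx : Fintype.card (TreeIdx L) = L ^ 3 - 1 := by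
  classical
  have hcard : Fintype.card (TreeIdx L) = ∑ x : Site 3 L, ∑ d : Fin 3, (if treeEdge (x, d) = true then 1 else 0) := by
    unfold TreeIdx
    rw [Fintype.card_subtype, Finset.card_filter, ← Finset.univ_product_univ, Finset.sum_product]
  have e0 : ∑ x : Site 3 L, (if x 1 = 0 ∧ x 2 = 0 ∧ x 0 ≠ -1 then 1 else 0) = L - 1 := by
    rw [sum_site_eq_sum_coord L (fun a b c => if b = 0 ∧ c = 0 ∧ a ≠ -1 then 1 else 0)]
    have hc : ∀ a b : ZMod L, ∑ c : ZMod L, (if b = 0 ∧ c = 0 ∧ a ≠ -1 then 1 else 0) =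
        if b = 0 then (if a ≠ -1 then 1 else 0) else 0 := by
      intro a b
      have hrw : ∀ c : ZMod L, (if b = 0 ∧ c = 0 ∧ a ≠ -1 then 1 else 0) =
          if c = 0 then (if b = 0 then (if a ≠ -1 then 1 else 0) else 0) else 0 := by
        intro c
        by_cases hb : b = 0 <;> by_cases hc0 : c = 0 <;> by_cases ha : a ≠ -1 <;> simp [hb, hc0, ha]
      rw [Finset.sum_congr rfl fun c _ => hrw c, Finset.sum_ite_eq' Finset.univ (0 : ZMod L)]
      simp
    have hb : ∀ a : ZMod L, ∑ b : ZMod L, (if b = 0 then (if a ≠ -1 then 1 else 0) else 0) = if a ≠ -1 then 1 else 0 := by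
      intro a
      rw [Finset.sum_ite_eq' Finset.univ (0 : ZMod L)]
      simp
    simp_rw [hc, hb]
    exact sum_ite_ne (-1)
  have e1 : ∑ x : Site 3 L, (if x 2 = 0 ∧ x 1 ≠ -1 then 1 else 0) = L * (L - 1) := by
    rw [sum_site_eq_sum_coord L (fun a b c => if c = 0 ∧ b ≠ -1 then 1 else 0)]
    have hc : ∀ b : ZMod L, ∑ c : ZMod L, (if c = 0 ∧ b ≠ -1 then 1 else 0) = if b ≠ -1 then 1 else 0 := by
      intro b
      have hrw : ∀ c : ZMod L, (if c = 0 ∧ b ≠ -1 then 1 else 0) = if c = 0 then (if b ≠ -1 then 1 else 0) else 0 := by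
        intro c
        by_cases hc0 : c = 0 <;> by_cases hb : b ≠ -1 <;> simp [hc0, hb]
      rw [Finset.sum_congr rfl fun c _ => hrw c, Finset.sum_ite_eq' Finset.univ (0 : ZMod L)]
      simp
    simp_rw [hc, sum_ite_ne (-1 : ZMod L), Finset.sum_const, Finset.card_univ, ZMod.card, smul_eq_mul]
  have e2 : ∑ x : Site 3 L, (if x 2 ≠ -1 then 1 else 0) = L * (L * (L - 1)) := by
    rw [sum_site_eq_sum_coord L (fun a b c => if c ≠ -1 then 1 else 0)]
    simp_rw [sum_ite_ne (-1 : ZMod L), Finset.sum_const, Finset.card_univ, ZMod.card, smul_eq_mul]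
  rw [hcard]
  simp_rw [sum_dir_treeEdge, Finset.sum_add_distrib]
  rw [e0, e1, e2]
  obtain ⟨m, rfl⟩ : ∃ m, L = m + 1 := ⟨L - 1, by have := NeZero.ne L; omega⟩
  rw [Nat.add_sub_cancel]
  exact Nat.eq_sub_of_add_eq (by ring)

/-! ## §3 Components of `X_fix` and the dimension of the slice model -/

/-- `#OffIdx = 2L³ + 1`. [cite: SeilerLNP1982, §2] -/
theorem card_offIdx : Fintype.card (OffIdx L) = 2 * L ^ 3 + 1 := by
  have h := card_tree_add_card_off (L := L)
  rw [card_treeIdx, card_edge_three] at h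
  have hL : 1 ≤ L ^ 3 := Nat.one_le_pow _ _ (Nat.pos_of_ne_zero (NeZero.ne L))
  omega

/-- ★ **`fixDim L e₀ y₀ = 18 L⁴`.** [folklore] -/
theorem fixDim_eq (e₀ : OffIdx L) (y₀ : Site 3 L) : fixDim L e₀ y₀ = 18 * L ^ 4 := by
  classical
  have c1 : Fintype.card {i : OffIdx L // ¬ i = e₀} = 2 * L ^ 3 := by
    rw [Fintype.card_subtype_compl, Fintype.card_subtype_eq, card_offIdx]
    omega
  have c3 : Fintype.card {y : Site 3 L // ¬ y = y₀} = L ^ 3 - 1 := by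
    rw [Fintype.card_subtype_compl, Fintype.card_subtype_eq, Literature.MathematicalPhysics.QuantumFieldTheory.card_site_three L]
  unfold fixDim FixIdx
  simp only [Fintype.card_sum, Fintype.card_prod, Fintype.card_fin, c1, c3,
    Literature.MathematicalPhysics.QuantumFieldTheory.card_site_three L]
  obtain ⟨m, rfl⟩ : ∃ m, L = m + 1 := ⟨L - 1, by have := NeZero.ne L; omega⟩
  have e1 : 2 * (m + 1) - 1 = 2 * m + 1 := by omega
  have e2 : (m + 1) ^ 3 - 1 = m ^ 3 + 3 * m ^ 2 + 3 * m := Nat.sub_eq_of_eq_add (by ring)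
  rw [e1, e2]
  ring

/-- ★ **`finrank ℝ V = 18 L⁴`** for the slice model `V = EuclideanSpace ℝ (Fin (fixDim L e₀ y₀))`. [folklore] -/
theorem finrank_fixModel (e₀ : OffIdx L) (y₀ : Site 3 L) :
    finrank ℝ (EuclideanSpace ℝ (Fin (fixDim L e₀ y₀))) = 18 * L ^ 4 := by
  rw [finrank_euclideanSpace_fin, fixDim_eq]

/-- The Gaussian exponent of the orbit theorem: `(finrank V : ℝ) / 2 = 9 L⁴`. [folklore] -/
theorem finrank_fixModel_div_two (e₀ : OffIdx L) (y₀ : Site 3 L) :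
    (finrank ℝ (EuclideanSpace ℝ (Fin (fixDim L e₀ y₀))) : ℝ) / 2 = (9 : ℝ) * (L : ℝ) ^ 4 := by
  rw [finrank_fixModel]
  push_cast
  ring

end Summit.QuantumFields.YangMills.Theorems.VirialFluxGap.FixSplit

end
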